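import Literature.Analysis.FluidPDE.TorusClassicalHnBalance
import Literature.Analysis.FunctionSpaces.TorusConvectionGradNormSq
import HarnessLib

/-!
# `H²` smoothing of classical Navier–Stokes solutions on `T³` under an enstrophy bound

Analysis/FluidPDE proof file (theorems only; no definitions, no named facts), sequel of
`TorusClassicalH1Balance.lean` / `TorusClassicalHnBalance.lean` (the balances of `½‖∇u‖₂²` and
`½‖Δu‖₂²` along classical solutions) and `FunctionSpaces/TorusConvectionGradNormSq.lean`
(`‖∇((u·∇)u)‖₂² ≤ C (‖∇u‖₂² + ‖Δu‖₂²) ‖Δu‖₂²` on `T³`). For a classical solution `(u, p)` of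
the forced incompressible Navier–Stokes system on `T^d × [a, a + τ]`, `card d = 3`, `ν > 0`, with
zero-mean velocity slices, the main theorem
`Torus.IsClassicalNSSolutionOn.integral_norm_laplacian_sq_le_of_gradNormSq_le` is the
QUANTITATIVE PARABOLIC SMOOTHING ESTIMATE in `H²`:

`sup_{[a, a+τ]} ‖∇u‖₂² ≤ E₁`, `sup_{[a, a+τ]} ‖∇f‖₂² ≤ G`  ⟹  `‖Δu(a + τ)‖₂² ≤ C(d, ν, E₁, G, τ)`,

with a constant independent of `a`, of the solution and of `‖Δu(a)‖₂` — the `k = 2` step of the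
regularity of strong solutions (Robinson–Rodrigo–Sadowski 2016, Thm 7.1: `d/dt ‖u‖²_{H²} +
‖∇u‖²_{H²} ≤ (c‖u‖²_{H²}) ‖u‖²_{H²}` with `∫₀ᵀ ‖u‖²_{H²} < ∞`, Grönwall; Thm 7.3: start from a time
`s₁ ∈ (0, ε)` at which `u(s₁) ∈ H²`; Constantin–Foias 1988, Thm 10.6, the periodic case). It
makes compact invariant sets of strong solutions bounded in `H²`. Also here: the flux bounds
`Torus.IsClassicalNSSolutionOn.enstrophy_flux_le` (`H¹` balance) and `….laplacian_flux_le` (`H²`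
balance, zero-mean slices), the `H²` balance without iterates
`….hasDerivWithinAt_half_integral_norm_laplacian_sq`, and Young's inequality
`Torus.abs_integral_inner_laplacian_le_gradNormSq` for `∫ ⟪a, Δw⟫`.

Proof road (no time integrals), `E = ‖∇u‖₂²`, `Y = ‖Δu‖₂²`: (i) `(½E)' ≤ −(ν/2)Y + A₁`; by
the Lagrange mean value theorem on `[a, a + τ/2]` there is `ξ` with `(½E)'(ξ) ≥ −E₁/τ`, whence
`Y(ξ) ≤ (2/ν)(A₁ + E₁/τ)`; (ii) `(log(1 + Y))' = Y'/(1 + Y) ≤ G/ν + B·Y`, `B = C(E₁ + 1)/ν`;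
(iii) `Ψ = log(1 + Y) + (2B/ν)(½E)` has `Ψ' ≤ G/ν + 2BA₁/ν`, so the fencing lemma
(`image_le_of_deriv_right_le_deriv_boundary`) bounds `Ψ(a + τ) ≤ Ψ(ξ) + (G/ν + 2BA₁/ν)τ`.
Deliberately NOT here: the `H^m` ladder for `m ≥ 3`, time derivatives, existence of solutions.

## Mathlib / tree search

Tree (reused): `Torus.IsClassicalNSSolutionOn.hasDerivWithinAt_half_gradNormSq`,
`…hasDerivWithinAt_half_integral_norm_sq_laplacian_iterate`,
`Torus.sum_integral_inner_partialDeriv_eq_neg_integral_inner_laplacian` (`TorusClassicalH1Balance`,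
`TorusClassicalHnBalance`), `Torus.abs_integral_inner_convect_laplacian_le_dissipation`
(`TorusEnstrophyTrilinear`), `Torus.gradNormSq_convect_self_le`,
`Torus.abs_sum_integral_inner_partialDeriv_le` (`TorusConvectionGradNormSq`); Mathlib
`exists_hasDerivAt_eq_slope`, `image_le_of_deriv_right_le_deriv_boundary`, `HasDerivWithinAt.log`.
Searched `laplacian_sq_le`, `H2`, `smoothing` for classical torus solutions: only the `ℝ³`
cutoff version `NSH1BoundedSmoothing` (different machinery).

## References

* J. C. Robinson, J. L. Rodrigo, W. Sadowski, *The Three-Dimensional Navier–Stokes Equations*,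
  CUP 2016, Thm 7.1, Thm 7.3. [RobinsonRodrigoSadowskiCUP2016]
* P. Constantin, C. Foias, *Navier–Stokes Equations*, Univ. Chicago Press 1988, Ch. 10,
  Thm 10.6 and (10.16) (periodic case). [ConstantinFoiasNSE1988]
-/

noncomputable section

open MeasureTheory Set Function Filter
open scoped ContDiff InnerProductSpace RealInnerProductSpace Topology NNReal

namespace Literature.Analysis.FluidPDE

open Literature.Analysis.FunctionSpaces

variable {d : Type*} [Fintype d] [DecidableEq d]

/-! ### Young's inequality for pairings with a Laplacian -/

/-- **`|∫ ⟪a, Δw⟫| ≤ (ε/2) ‖∇a‖₂² + (2ε)⁻¹ ‖∇w‖₂²`** for smooth fields on `T^d` and `ε > 0`: Green's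
first identity `∫ ⟪a, Δw⟫ = −∑ᵢ ∫ ⟪∂ᵢa, ∂ᵢw⟫` and Young's inequality for gradient pairings
(`Torus.abs_sum_integral_inner_partialDeriv_le`). [folklore] -/
theorem Torus.abs_integral_inner_laplacian_le_gradNormSq {a w : UnitAddTorus d → EuclideanSpace ℝ d}
    (ha : Torus.IsSmooth a) (hw : Torus.IsSmooth w) {ε : ℝ} (hε : 0 < ε) :
    |∫ x, ⟪a x, Torus.laplacian w x⟫| ≤ ε / 2 * Torus.gradNormSq a + (2 * ε)⁻¹ * Torus.gradNormSq w := by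
  have hG := Torus.sum_integral_inner_partialDeriv_eq_neg_integral_inner_laplacian ha hw
  have heq : ∫ x, ⟪a x, Torus.laplacian w x⟫ =
      -∑ i, ∫ x, ⟪Torus.partialDeriv i a x, Torus.partialDeriv i w x⟫ := by
    rw [hG, neg_neg]
  rw [heq, abs_neg]
  exact Torus.abs_sum_integral_inner_partialDeriv_le ha hw hε

/-! ### The flux bounds of the `H¹` and `H²` balances -/

/-- The force slice of a classical solution on `[a, b]`, `a < b`, is smooth (it is determined by
the momentum equation; private copy of the lemma of `NSCoriolisUniqueness`, not imported here).
[folklore] -/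
private theorem isSmooth_force_slice {a b ν : ℝ} {f u : ℝ → UnitAddTorus d → EuclideanSpace ℝ d}
    {p : ℝ → UnitAddTorus d → ℝ} (h : Torus.IsClassicalNSSolutionOn (Icc a b) ν f u p) (hab : a < b)
    {t : ℝ} (ht : t ∈ Icc a b) : Torus.IsSmooth (f t) := by
  have hut : Torus.IsSmooth (u t) := h.smooth_velocity.isSmooth_slice ht
  have hA : Torus.IsSmooth (Torus.timeDerivWithin (Icc a b) u t) :=
    h.smooth_velocity.isSmooth_timeDerivWithin (uniqueDiffOn_Icc hab) ht
  have hpt : Torus.IsSmooth (p t) := h.smooth_pressure.isSmooth_slice ht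
  have hfun : f t = fun x => Torus.timeDerivWithin (Icc a b) u t x +
      Torus.convect (u t) (u t) x - ν • Torus.laplacian (u t) x + Torus.gradient (p t) x := by
    funext x
    rw [h.momentum t ht x]
    abel
  rw [hfun]
  exact ((hA.add (hut.convect hut)).sub (hut.laplacian.smul ν)).add hpt.gradient

/-- **Flux bound of the `H¹` balance on `T³`.** On `T^d` with `card d = 3` there is `K` such that
for every `ν > 0` and every classical solution on `[a, b]`, `a < b`, at every `t ∈ [a, b]` the
right-hand side of `Torus.IsClassicalNSSolutionOn.hasDerivWithinAt_half_gradNormSq` satisfies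
`−ν‖Δu‖₂² + ∫ ⟪(u·∇)u − f, Δu⟫ ≤ −(ν/2)‖Δu‖₂² + 8K⁴ν⁻³ (‖∇u‖₂²)³ + ½ (‖∇f‖₂² + ‖∇u‖₂²)`
(the trilinear term by `Torus.abs_integral_inner_convect_laplacian_le_dissipation`, the force
term by `|∫ ⟪f, Δu⟫| ≤ ½‖∇f‖₂² + ½‖∇u‖₂²`) — a variant of the enstrophy inequality (10.16) of
Constantin–Foias 1988 (there with `2|f|²/ν` for the force term). [folklore] -/
theorem _root_.Literature.Analysis.FunctionSpaces.Torus.IsClassicalNSSolutionOn.enstrophy_flux_le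
    (hd : Fintype.card d = 3) :
    ∃ K : ℝ≥0, ∀ (ν : ℝ), 0 < ν → ∀ {a b : ℝ} {f u : ℝ → UnitAddTorus d → EuclideanSpace ℝ d}
      {p : ℝ → UnitAddTorus d → ℝ}, Torus.IsClassicalNSSolutionOn (Icc a b) ν f u p → a < b →
      ∀ {t : ℝ}, t ∈ Icc a b →
        -ν * (∫ x, ‖Torus.laplacian (u t) x‖ ^ 2) +
            ∫ x, ⟪Torus.convect (u t) (u t) x - f t x, Torus.laplacian (u t) x⟫ ≤
          -(ν / 2) * (∫ x, ‖Torus.laplacian (u t) x‖ ^ 2) +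
            (8 * (K : ℝ) ^ 4 / ν ^ 3 * Torus.gradNormSq (u t) ^ 3 +
              2⁻¹ * (Torus.gradNormSq (f t) + Torus.gradNormSq (u t))) := by
  obtain ⟨K, hK⟩ := Torus.abs_integral_inner_convect_laplacian_le_dissipation (d := d) hd
  refine ⟨K, fun ν hν a b f u p h hab t ht => ?_⟩
  have hut : Torus.IsSmooth (u t) := h.smooth_velocity.isSmooth_slice ht
  have hft : Torus.IsSmooth (f t) := isSmooth_force_slice h hab ht
  have hΔ : Torus.IsSmooth (Torus.laplacian (u t)) := hut.laplacian
  have h1 := hK ν hν (u t) hut (h.divFree t ht)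
  have h2 := Torus.abs_integral_inner_laplacian_le_gradNormSq hft hut one_pos
  have iC : Integrable (fun x => ⟪Torus.convect (u t) (u t) x, Torus.laplacian (u t) x⟫) volume :=
    ((hut.convect hut).inner hΔ).integrable
  have iF : Integrable (fun x => ⟪f t x, Torus.laplacian (u t) x⟫) volume := (hft.inner hΔ).integrable
  have hsplit : ∫ x, ⟪Torus.convect (u t) (u t) x - f t x, Torus.laplacian (u t) x⟫ =
      (∫ x, ⟪Torus.convect (u t) (u t) x, Torus.laplacian (u t) x⟫) -
        ∫ x, ⟪f t x, Torus.laplacian (u t) x⟫ := by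
    simp_rw [inner_sub_left]
    exact integral_sub iC iF
  rw [hsplit]
  norm_num at h2
  have h1' := (le_abs_self _).trans h1
  have h2' := (neg_le_abs _).trans h2
  linarith [h1', h2']

/-- **The `H²` balance of classical Navier–Stokes solutions on the torus** (the case `n = 1` of
`Torus.IsClassicalNSSolutionOn.hasDerivWithinAt_half_integral_norm_sq_laplacian_iterate`, spelled
without iterates): `d/dt ½ ∫ ‖Δu(t)‖² = −ν ‖∇Δu(t)‖₂² − ∫ ⟪(u·∇)u(t) − f(t), ΔΔu(t)⟫` within
`[a, b]`. [cite: FoiasManleyRosaTemam2001, Ch. II App. A (A.55) and §7] -/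
theorem _root_.Literature.Analysis.FunctionSpaces.Torus.IsClassicalNSSolutionOn.hasDerivWithinAt_half_integral_norm_laplacian_sq
    {a b ν : ℝ} {f u : ℝ → UnitAddTorus d → EuclideanSpace ℝ d} {p : ℝ → UnitAddTorus d → ℝ}
    (h : Torus.IsClassicalNSSolutionOn (Icc a b) ν f u p) (hab : a < b) {t : ℝ} (ht : t ∈ Icc a b) :
    HasDerivWithinAt (fun s => 2⁻¹ * ∫ x, ‖Torus.laplacian (u s) x‖ ^ 2)
      (-ν * Torus.gradNormSq (Torus.laplacian (u t)) -
        ∫ x, ⟪Torus.convect (u t) (u t) x - f t x, Torus.laplacian (Torus.laplacian (u t)) x⟫)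
      (Icc a b) t := by
  -- `Δ^[1] v = Δ v` and `Δ^[2 * 1] v = Δ (Δ v)` hold by `rfl`
  exact h.hasDerivWithinAt_half_integral_norm_sq_laplacian_iterate hab 1 ht

/-- **Flux bound of the `H²` balance on `T³` for zero-mean slices.** On `T^d` with `card d = 3`
there is `C ≥ 0` such that for every `ν > 0` and every classical solution on `[a, b]`, `a < b`,
at every `t ∈ [a, b]` with `∫ u(t) = 0`,
`−ν‖∇Δu‖₂² − ∫ ⟪(u·∇)u − f, ΔΔu⟫ ≤ (2ν)⁻¹ (‖∇f‖₂² + C (‖∇u‖₂² + ‖Δu‖₂²) ‖Δu‖₂²)`: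
both pairings by `Torus.abs_integral_inner_laplacian_le_gradNormSq` with `ε = ν⁻¹` (absorbing
`ν‖∇Δu‖₂²`), then `‖∇((u·∇)u)‖₂² ≤ C (‖∇u‖₂² + ‖Δu‖₂²) ‖Δu‖₂²` (`Torus.gradNormSq_convect_self_le`)
— the differential inequality (7.3) of Robinson–Rodrigo–Sadowski 2016 for `k = 2`, with a force.
[cite: RobinsonRodrigoSadowskiCUP2016, Thm 7.1 (7.3)] -/
theorem _root_.Literature.Analysis.FunctionSpaces.Torus.IsClassicalNSSolutionOn.laplacian_flux_le
    (hd : Fintype.card d = 3) :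
    ∃ C : ℝ, 0 ≤ C ∧ ∀ (ν : ℝ), 0 < ν → ∀ {a b : ℝ} {f u : ℝ → UnitAddTorus d → EuclideanSpace ℝ d}
      {p : ℝ → UnitAddTorus d → ℝ}, Torus.IsClassicalNSSolutionOn (Icc a b) ν f u p → a < b →
      ∀ {t : ℝ}, t ∈ Icc a b → Torus.HasZeroMean (u t) →
        -ν * Torus.gradNormSq (Torus.laplacian (u t)) -
            ∫ x, ⟪Torus.convect (u t) (u t) x - f t x, Torus.laplacian (Torus.laplacian (u t)) x⟫ ≤
          (2 * ν)⁻¹ * (Torus.gradNormSq (f t) +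
            C * (Torus.gradNormSq (u t) + ∫ x, ‖Torus.laplacian (u t) x‖ ^ 2) *
              ∫ x, ‖Torus.laplacian (u t) x‖ ^ 2) := by
  obtain ⟨C, hC0, hC⟩ := Torus.gradNormSq_convect_self_le (d := d) hd
  refine ⟨C, hC0, fun ν hν a b f u p h hab t ht h0 => ?_⟩
  have hut : Torus.IsSmooth (u t) := h.smooth_velocity.isSmooth_slice ht
  have hft : Torus.IsSmooth (f t) := isSmooth_force_slice h hab ht
  have hB : Torus.IsSmooth (Torus.convect (u t) (u t)) := hut.convect hut
  have hΔ : Torus.IsSmooth (Torus.laplacian (u t)) := hut.laplacian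
  have hΔΔ : Torus.IsSmooth (Torus.laplacian (Torus.laplacian (u t))) := hΔ.laplacian
  have hε : 0 < ν⁻¹ := inv_pos.2 hν
  have h1 := Torus.abs_integral_inner_laplacian_le_gradNormSq hB hΔ hε
  have h2 := Torus.abs_integral_inner_laplacian_le_gradNormSq hft hΔ hε
  have h3 := hC (u t) hut h0
  have iC : Integrable (fun x => ⟪Torus.convect (u t) (u t) x, Torus.laplacian (Torus.laplacian (u t)) x⟫)
      volume := (hB.inner hΔΔ).integrable
  have iF : Integrable (fun x => ⟪f t x, Torus.laplacian (Torus.laplacian (u t)) x⟫) volume :=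
    (hft.inner hΔΔ).integrable
  have hsplit : ∫ x, ⟪Torus.convect (u t) (u t) x - f t x, Torus.laplacian (Torus.laplacian (u t)) x⟫ =
      (∫ x, ⟪Torus.convect (u t) (u t) x, Torus.laplacian (Torus.laplacian (u t)) x⟫) -
        ∫ x, ⟪f t x, Torus.laplacian (Torus.laplacian (u t)) x⟫ := by
    simp_rw [inner_sub_left]
    exact integral_sub iC iF
  rw [hsplit]
  have hinv : (2 * ν⁻¹)⁻¹ = ν / 2 := by
    rw [mul_inv, inv_inv]; ring
  rw [hinv] at h1 h2
  have h1' := (neg_le_abs _).trans h1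
  have h2' := (le_abs_self _).trans h2
  have hZ0 : 0 ≤ Torus.gradNormSq (Torus.laplacian (u t)) := Torus.gradNormSq_nonneg _
  have hkey : -ν * Torus.gradNormSq (Torus.laplacian (u t)) -
      ((∫ x, ⟪Torus.convect (u t) (u t) x, Torus.laplacian (Torus.laplacian (u t)) x⟫) -
        ∫ x, ⟪f t x, Torus.laplacian (Torus.laplacian (u t)) x⟫) ≤
      ν⁻¹ / 2 * Torus.gradNormSq (Torus.convect (u t) (u t)) + ν⁻¹ / 2 * Torus.gradNormSq (f t) := by
    linarith [h1', h2', hZ0]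
  refine hkey.trans ?_
  have hν2 : ν⁻¹ / 2 = (2 * ν)⁻¹ := by rw [mul_inv]; ring
  rw [hν2, ← mul_add, add_comm]
  exact mul_le_mul_of_nonneg_left (add_le_add le_rfl h3) (by positivity)

/-! ### The smoothing estimate -/

/-- **Quantitative `H²` smoothing of classical Navier–Stokes solutions on `T³` under an enstrophy
bound** (Robinson–Rodrigo–Sadowski 2016, Thm 7.1 with Thm 7.3, `k = m = 2`; Constantin–Foias
1988, Thm 10.6, periodic case): on `T^d` with `card d = 3`, for `ν > 0`, an enstrophy level `E₁`,
a force level `G` and a time lapse `τ > 0` there is a constant `C` such that for EVERY classical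
solution `(u, p)` of the Navier–Stokes system with force `f` on `[a, a + τ] × T^d` whose velocity
slices have zero mean, `‖∇u(t)‖₂² ≤ E₁` and `‖∇f(t)‖₂² ≤ G` for `t ∈ [a, a + τ]`, one has
`∫ ‖Δu(a + τ)‖² ≤ C` — uniformly in `a`, in the solution and in `‖Δu(a)‖₂`. Proof: the flux
bounds `enstrophy_flux_le` / `laplacian_flux_le`, a time `ξ ∈ (a, a + τ/2)` with
`‖Δu(ξ)‖₂² ≤ (2/ν)(A₁ + E₁/τ)` from the Lagrange mean value theorem applied to `½‖∇u‖₂²`, and the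
fencing lemma for `Ψ = log(1 + ‖Δu‖₂²) + λ·½‖∇u‖₂²`, whose derivative is bounded by a constant.
[cite: RobinsonRodrigoSadowskiCUP2016, Thm 7.1 and Thm 7.3] -/
theorem _root_.Literature.Analysis.FunctionSpaces.Torus.IsClassicalNSSolutionOn.integral_norm_laplacian_sq_le_of_gradNormSq_le
    (hd : Fintype.card d = 3) {ν : ℝ} (hν : 0 < ν) (E₁ G : ℝ) {τ : ℝ} (hτ : 0 < τ) :
    ∃ C : ℝ, ∀ {a : ℝ} {f u : ℝ → UnitAddTorus d → EuclideanSpace ℝ d} {p : ℝ → UnitAddTorus d → ℝ},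
      Torus.IsClassicalNSSolutionOn (Icc a (a + τ)) ν f u p →
      (∀ t ∈ Icc a (a + τ), Torus.HasZeroMean (u t)) →
      (∀ t ∈ Icc a (a + τ), Torus.gradNormSq (u t) ≤ E₁) →
      (∀ t ∈ Icc a (a + τ), Torus.gradNormSq (f t) ≤ G) →
        ∫ x, ‖Torus.laplacian (u (a + τ)) x‖ ^ 2 ≤ C := by
  obtain ⟨K, hK⟩ := Torus.IsClassicalNSSolutionOn.enstrophy_flux_le (d := d) hd
  obtain ⟨C, hC0, hC⟩ := Torus.IsClassicalNSSolutionOn.laplacian_flux_le (d := d) hd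
  have hν0 : ν ≠ 0 := hν.ne'
  -- the constants (all depend on `d, ν, E₁, G, τ` only)
  set E₁' : ℝ := max E₁ 0 with hE₁'
  set G' : ℝ := max G 0 with hG'
  have hE₁'0 : 0 ≤ E₁' := le_max_right _ _
  have hG'0 : 0 ≤ G' := le_max_right _ _
  set A₁ : ℝ := 8 * (K : ℝ) ^ 4 / ν ^ 3 * E₁' ^ 3 + 2⁻¹ * (G' + E₁') with hA₁
  have hA₁0 : 0 ≤ A₁ := by positivity
  set L : ℝ := 2 / ν * (A₁ + E₁' / τ) with hL
  have hL0 : 0 ≤ L := by positivity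
  set B : ℝ := C * (E₁' + 1) / ν with hB
  have hB0 : 0 ≤ B := by positivity
  set lam : ℝ := 2 * B / ν with hlam
  have hlam0 : 0 ≤ lam := by positivity
  set A₂ : ℝ := G' / ν + lam * A₁ with hA₂
  have hA₂0 : 0 ≤ A₂ := by positivity
  refine ⟨(1 + L) * Real.exp (lam * (2⁻¹ * E₁') + A₂ * τ), fun {a f u p} h h0 hE hG => ?_⟩
  set b : ℝ := a + τ with hb
  have hab : a < b := by rw [hb]; linarith
  -- notation for the two energies along the solution
  set Eh : ℝ → ℝ := fun s => 2⁻¹ * Torus.gradNormSq (u s) with hEh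
  set Y : ℝ → ℝ := fun s => ∫ x, ‖Torus.laplacian (u s) x‖ ^ 2 with hY
  set Eh' : ℝ → ℝ := fun s => -ν * (∫ x, ‖Torus.laplacian (u s) x‖ ^ 2) +
    ∫ x, ⟪Torus.convect (u s) (u s) x - f s x, Torus.laplacian (u s) x⟫ with hEh'
  set Yh' : ℝ → ℝ := fun s => -ν * Torus.gradNormSq (Torus.laplacian (u s)) -
    ∫ x, ⟪Torus.convect (u s) (u s) x - f s x, Torus.laplacian (Torus.laplacian (u s)) x⟫ with hYh'
  have hY0 : ∀ s, 0 ≤ Y s := fun s => integral_nonneg fun x => sq_nonneg _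
  have hEh0 : ∀ s, 0 ≤ Eh s := fun s => mul_nonneg (by norm_num) (Torus.gradNormSq_nonneg _)
  have hE' : ∀ s ∈ Icc a b, Torus.gradNormSq (u s) ≤ E₁' := fun s hs => (hE s hs).trans (le_max_left _ _)
  have hG'' : ∀ s ∈ Icc a b, Torus.gradNormSq (f s) ≤ G' := fun s hs => (hG s hs).trans (le_max_left _ _)
  -- the two balances and their flux bounds
  have hdE : ∀ s ∈ Icc a b, HasDerivWithinAt Eh (Eh' s) (Icc a b) s := fun s hs =>
    h.hasDerivWithinAt_half_gradNormSq hab hs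
  have hdY : ∀ s ∈ Icc a b, HasDerivWithinAt (fun r => 2⁻¹ * Y r) (Yh' s) (Icc a b) s := fun s hs =>
    h.hasDerivWithinAt_half_integral_norm_laplacian_sq hab hs
  have hEh'le : ∀ s ∈ Icc a b, Eh' s ≤ -(ν / 2) * Y s + A₁ := by
    intro s hs
    have hEs := hE' s hs
    have h6 : 8 * (K : ℝ) ^ 4 / ν ^ 3 * Torus.gradNormSq (u s) ^ 3 ≤ 8 * (K : ℝ) ^ 4 / ν ^ 3 * E₁' ^ 3 :=
      mul_le_mul_of_nonneg_left (pow_le_pow_left₀ (Torus.gradNormSq_nonneg _) hEs 3) (by positivity)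
    calc Eh' s ≤ -(ν / 2) * Y s + (8 * (K : ℝ) ^ 4 / ν ^ 3 * Torus.gradNormSq (u s) ^ 3 +
          2⁻¹ * (Torus.gradNormSq (f s) + Torus.gradNormSq (u s))) := hK ν hν h hab hs
      _ ≤ -(ν / 2) * Y s + A₁ := by rw [hA₁]; linarith [h6, hEs, hG'' s hs]
  have hYh'le : ∀ s ∈ Icc a b, Yh' s ≤ (2 * ν)⁻¹ * (G' + C * (E₁' + Y s) * Y s) := by
    intro s hs
    have h5 : C * (Torus.gradNormSq (u s) + Y s) * Y s ≤ C * (E₁' + Y s) * Y s :=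
      mul_le_mul_of_nonneg_right (mul_le_mul_of_nonneg_left (by linarith [hE' s hs]) hC0) (hY0 s)
    calc Yh' s ≤ (2 * ν)⁻¹ * (Torus.gradNormSq (f s) + C * (Torus.gradNormSq (u s) + Y s) * Y s) :=
          hC ν hν h hab hs (h0 s hs)
      _ ≤ (2 * ν)⁻¹ * (G' + C * (E₁' + Y s) * Y s) :=
          mul_le_mul_of_nonneg_left (add_le_add (hG'' s hs) h5) (by positivity)
  -- Step 1: a time `ξ ∈ (a, a + τ/2)` with `Y ξ ≤ L` (Lagrange on `½‖∇u‖₂²`)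
  set m : ℝ := a + τ / 2 with hm
  have ham : a < m := by rw [hm]; linarith
  have hmb : m < b := by rw [hm, hb]; linarith
  have hmmem : Icc a m ⊆ Icc a b := Icc_subset_Icc le_rfl hmb.le
  obtain ⟨ξ, hξ, hslope⟩ : ∃ ξ ∈ Ioo a m, Eh' ξ = (Eh m - Eh a) / (m - a) := by
    refine exists_hasDerivAt_eq_slope Eh Eh' ham ?_ ?_
    · exact fun s hs => ((hdE s (hmmem hs)).continuousWithinAt).mono hmmem
    · intro s hs
      exact (hdE s (hmmem (Ioo_subset_Icc_self hs))).hasDerivAt (Icc_mem_nhds hs.1 (hs.2.trans hmb))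
  have hξab : ξ ∈ Icc a b := ⟨hξ.1.le, (hξ.2.trans hmb).le⟩
  have hYξ : Y ξ ≤ L := by
    have hsl : -(E₁' / τ) ≤ Eh' ξ := by
      rw [hslope, le_div_iff₀ (sub_pos.2 ham)]
      have hma : m - a = τ / 2 := by rw [hm]; ring
      have h1 : Eh a ≤ 2⁻¹ * E₁' := mul_le_mul_of_nonneg_left (hE' a (left_mem_Icc.2 hab.le)) (by norm_num)
      have h2 : 0 ≤ Eh m := hEh0 m
      have h5 : -(E₁' / τ) * (τ / 2) = -(2⁻¹ * E₁') := by field_simp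
      rw [hma, h5]
      linarith
    have h3 := hEh'le ξ hξab
    have h4 : ν / 2 * Y ξ ≤ A₁ + E₁' / τ := by linarith
    calc Y ξ = 2 / ν * (ν / 2 * Y ξ) := by field_simp
      _ ≤ 2 / ν * (A₁ + E₁' / τ) := mul_le_mul_of_nonneg_left h4 (by positivity)
  -- Step 2: the Lyapunov combination `Ψ = log (1 + Y) + lam * Eh` has `Ψ' ≤ A₂`
  set Ψ : ℝ → ℝ := fun s => Real.log (1 + Y s) + lam * Eh s with hΨ
  set Ψ' : ℝ → ℝ := fun s => 2 * Yh' s / (1 + Y s) + lam * Eh' s with hΨ'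
  have hdΨ : ∀ s ∈ Icc a b, HasDerivWithinAt Ψ (Ψ' s) (Icc a b) s := by
    intro s hs
    have hY1 : HasDerivWithinAt Y (2 * Yh' s) (Icc a b) s := by
      have h2 := (hdY s hs).const_mul (2 : ℝ)
      exact h2.congr (fun r _ => by ring) (by ring)
    have hpos : 1 + Y s ≠ 0 := by have := hY0 s; positivity
    have hlog := ((hasDerivWithinAt_const s (Icc a b) (1 : ℝ)).add hY1).log hpos
    rw [zero_add] at hlog
    exact hlog.add ((hdE s hs).const_mul lam)
  have hΨ'le : ∀ s ∈ Icc a b, Ψ' s ≤ A₂ := by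
    intro s hs
    have hYs := hY0 s
    have h1Y : 0 < 1 + Y s := by positivity
    have hnum : 2 * Yh' s ≤ ν⁻¹ * G' + B * Y s * (1 + Y s) := by
      have h1 := hYh'le s hs
      have h2 : 2 * Yh' s ≤ ν⁻¹ * (G' + C * (E₁' + Y s) * Y s) := by
        have : 2 * ((2 * ν)⁻¹ * (G' + C * (E₁' + Y s) * Y s)) = ν⁻¹ * (G' + C * (E₁' + Y s) * Y s) := by
          rw [mul_inv]; ring
        rw [← this]; linarith
      have h3 : C * (E₁' + Y s) * Y s ≤ C * (E₁' + 1) * (Y s * (1 + Y s)) := by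
        have hx : 0 ≤ E₁' * Y s ^ 2 + Y s := by positivity
        have e : (E₁' + 1) * (Y s * (1 + Y s)) - (E₁' + Y s) * Y s = E₁' * Y s ^ 2 + Y s := by ring
        have h7 : (E₁' + Y s) * Y s ≤ (E₁' + 1) * (Y s * (1 + Y s)) := by linarith [hx, e]
        have h8 := mul_le_mul_of_nonneg_left h7 hC0
        calc C * (E₁' + Y s) * Y s = C * ((E₁' + Y s) * Y s) := by ring
          _ ≤ C * ((E₁' + 1) * (Y s * (1 + Y s))) := h8
          _ = C * (E₁' + 1) * (Y s * (1 + Y s)) := by ring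
      calc 2 * Yh' s ≤ ν⁻¹ * (G' + C * (E₁' + Y s) * Y s) := h2
        _ ≤ ν⁻¹ * (G' + C * (E₁' + 1) * (Y s * (1 + Y s))) :=
            mul_le_mul_of_nonneg_left (add_le_add le_rfl h3) (inv_pos.2 hν).le
        _ = ν⁻¹ * G' + B * Y s * (1 + Y s) := by rw [hB]; field_simp
    have hfrac : 2 * Yh' s / (1 + Y s) ≤ ν⁻¹ * G' + B * Y s := by
      rw [div_le_iff₀ h1Y]
      have hx : 0 ≤ ν⁻¹ * G' * Y s := by positivity
      have e : (ν⁻¹ * G' + B * Y s) * (1 + Y s) = ν⁻¹ * G' + ν⁻¹ * G' * Y s + B * Y s * (1 + Y s) := by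
        ring
      rw [e]
      linarith [hnum, hx]
    have h4 := hEh'le s hs
    have h5 : lam * Eh' s ≤ lam * (-(ν / 2) * Y s + A₁) := mul_le_mul_of_nonneg_left h4 hlam0
    have h6 : lam * (-(ν / 2) * Y s) = -(B * Y s) := by
      rw [hlam]; field_simp
    calc Ψ' s = 2 * Yh' s / (1 + Y s) + lam * Eh' s := rfl
      _ ≤ (ν⁻¹ * G' + B * Y s) + lam * (-(ν / 2) * Y s + A₁) := add_le_add hfrac h5
      _ = ν⁻¹ * G' + lam * A₁ := by rw [mul_add, h6]; ring
      _ = A₂ := by rw [hA₂]; ring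
  -- Step 3: fencing on `[ξ, b]`
  have hΨc : ContinuousOn Ψ (Icc ξ b) := fun s hs =>
    ((hdΨ s ⟨hξab.1.trans hs.1, hs.2⟩).continuousWithinAt).mono (Icc_subset_Icc hξab.1 le_rfl)
  have hΨr : ∀ s ∈ Ico ξ b, HasDerivWithinAt Ψ (Ψ' s) (Ici s) s := fun s hs =>
    ((hdΨ s ⟨hξab.1.trans hs.1, hs.2.le⟩).mono (Icc_subset_Icc (hξab.1.trans hs.1) le_rfl)).mono_of_mem_nhdsWithin
      (Icc_mem_nhdsGE hs.2)
  have hfence := image_le_of_deriv_right_le_deriv_boundary hΨc hΨr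
    (B := fun s => Ψ ξ + A₂ * (s - ξ)) (B' := fun _ => A₂) (by simp)
    (by fun_prop)
    (fun s _ => by
      have h1 : HasDerivWithinAt (fun r => Ψ ξ + A₂ * (r - ξ)) (0 + A₂ * (1 - 0)) (Ici s) s :=
        (hasDerivWithinAt_const _ _ _).add (((hasDerivWithinAt_id _ _).sub
          (hasDerivWithinAt_const _ _ _)).const_mul A₂)
      simpa using h1)
    (fun s hs => hΨ'le s ⟨hξab.1.trans hs.1, hs.2.le⟩) (right_mem_Icc.2 hξab.2)
  have hfence' : Ψ b ≤ Ψ ξ + A₂ * (b - ξ) := hfence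
  -- Step 4: unwind `Ψ b ≤ Ψ ξ + A₂ (b - ξ)`
  have hΨξ : Ψ ξ ≤ Real.log (1 + L) + lam * (2⁻¹ * E₁') := by
    have h1 : Real.log (1 + Y ξ) ≤ Real.log (1 + L) :=
      Real.log_le_log (by have := hY0 ξ; positivity) (by linarith)
    have h2 : lam * Eh ξ ≤ lam * (2⁻¹ * E₁') :=
      mul_le_mul_of_nonneg_left (mul_le_mul_of_nonneg_left (hE' ξ hξab) (by norm_num)) hlam0
    exact add_le_add h1 h2
  have hbξ : A₂ * (b - ξ) ≤ A₂ * τ := by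
    refine mul_le_mul_of_nonneg_left ?_ hA₂0
    rw [hb]; linarith [hξ.1]
  have hlogb : Real.log (1 + Y b) ≤ Real.log (1 + L) + (lam * (2⁻¹ * E₁') + A₂ * τ) := by
    have h1 : Real.log (1 + Y b) ≤ Ψ b := le_add_of_nonneg_right (mul_nonneg hlam0 (hEh0 b))
    linarith [hfence', hΨξ, hbξ, h1]
  have h1Yb : 0 < 1 + Y b := by have := hY0 b; positivity
  have hexp : 1 + Y b ≤ (1 + L) * Real.exp (lam * (2⁻¹ * E₁') + A₂ * τ) := by
    have h2 := Real.exp_le_exp.2 hlogb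
    rwa [Real.exp_log h1Yb, Real.exp_add, Real.exp_log (by positivity)] at h2
  linarith [hexp]

end Literature.Analysis.FluidPDE

end
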